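import Summits.QuantumFields.BalabanUV.T4Continuum.Support.NE7K1LinSchurLineForm
import Literature.MathematicalPhysics.QuantumFieldTheory.Balaban1983to89.Beta.CombesThomasFormOp

/-!
# NE7K1LinSchurLineDeriv — row NE7 (node U5), candidate route HOM, path H1L, cell K1-lin(s): the `∂_s` LETTER WITH DECAY — the
# difference `G(s) − G(t) = (t−s)·G(s)(P₁ − P₀)G(t)` of the interpolated-Schur propagators is bounded in the WEIGHTED `ℓ²` norm by
# `|t−s|` times an `s`-FREE constant, for every admissible Combes–Thomas weight (form currency; PRICING-NE7 v16.1 §98 P-v16.1-3)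

Lineage `b2b-balaban-t4-ne7-p2` (CRUX PROVER NE7 #2), generation 63; seventh piece of the cell after `NE7K1LinSchurLine` p284751,
`…Form` p285160, `…Coords` p285751, `NE7K1LinFineOpWeight` p285983, `NE7K1LinBlockCoords` p286360, `…U1` p287307 (all ✓).  WHY: K2∕K3′ on
path H1L differentiate along the line; `NE7K1LinSchurLine.lineOp_inv_sub_inv` gives the identity, and the refuter's precision P-v16.1-3
(= lens 1's (π1)) says the middle factor `P₁ − P₀ = A₁ − BD⁻¹C − P₀` decays «by the same theorem applied to `D` alone».  THIS FILE proves
exactly that, abstractly ([folklore], real matrices, 0 Bałaban letters): under the four hypotheses of `lineOpR_inv_decay_form` (coercivity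
floor `σ` and conjugation-error bound at a weight `ρ` for `P₀` and for `H₁ = [[A₁,B],[C,D]]`) plus WEIGHTED `ℓ²` bounds `K_{P₀}, K_{A₁},
K_B, K_C` for the four finite-range blocks (the instantiator's Schur-test facts), for all `s, t ∈ [0,1]` and every right-hand side `g`:
  `‖e^{ρ_c}·((G(s) − G(t))g)‖² ≤ (t−s)²·(2∕σ)⁴·3·(K_{P₀}² + K_{A₁}² + K_B²(2∕σ)²K_C²)·‖e^{ρ_c}·g‖²`   (`wN_lineOpR_inv_sub_inv_le`),
`ρ_c = ρ ∘ inl` — every constant `s`-free and, with `Beta.CombesThomasForm`'s lattice weights, mesh-free.  Ingredients: `lineOpR_inv_sub_inv`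
(real twin of the d∕ds identity); `wN_lineOpR_inv_le` — the weighted bound `‖e^{ρ_c}G(s)v‖ ≤ (2∕σ)‖e^{ρ_c}v‖` read off the tree's OPERATOR
form `Beta.CombesThomasFormOp.combesThomas_form_op` applied to the √s-extended `𝒫(s)` at the right-hand side `(v, 0)` (the coarse block of
`𝒫(s)⁻¹(v,0)` IS `G(s)v`, `NE7K1LinSchurLineForm.inv_extOpR_inl_inl`); `wN_D_inv_le` — the same for the fine block `D` alone, whose coercivity
and conjugation error are those of `H₁` tested on `(0, φ)` (`coercive_D`, `conjError_D_ge`).  HONEST FRAMING: FIXED FINITE T⁴, rung (B)+1;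
NE7 NOT PRINTED ∕ NOT PROVED; spine 0∕9; NOT infinite volume, NOT mass gap, NOT Clay; nothing printed asserted; no `sorry`.  HONEST
DEPENDENCY: continuum YM on T⁴ ⇐ BetaPertH ∧ nine spine estimates (0/9 proved); BetaPertH ⇐ (D1) ∧ (D4) ∧ CAP+tail; G-an2-4 gates asym,
D1 and NE2/3/4.
-/

noncomputable section

open Finset Matrix

namespace Summit.QuantumFields.BalabanUV.T4Continuum.NE7K1LinSchurLineDeriv

open NE7K1LinSchurLineForm
open Literature.MathematicalPhysics.QuantumFieldTheory.Balaban1983to89.Beta.CombesThomasFormOp (combesThomas_form_op)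

variable {ιc ιf : Type*} [Fintype ιc] [Fintype ιf] [DecidableEq ιc] [DecidableEq ιf]

/-- the weighted squared `ℓ²` norm `‖e^{ρ}·v‖² = Σ_i (e^{ρ_i}v_i)²`. [folklore] -/
def wN {ι : Type*} [Fintype ι] (ρ : ι → ℝ) (v : ι → ℝ) : ℝ := ∑ i, (Real.exp (ρ i) * v i) ^ 2

omit [Fintype ιf] [DecidableEq ιc] [DecidableEq ιf] in
/-- `wN` is nonnegative. [folklore] -/
theorem wN_nonneg (ρ v : ιc → ℝ) : 0 ≤ wN ρ v := Finset.sum_nonneg fun _ _ => sq_nonneg _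

omit [Fintype ιf] [DecidableEq ιc] [DecidableEq ιf] in
/-- `wN ρ (c·v) = c²·wN ρ v`. [folklore] -/
theorem wN_smul (ρ v : ιc → ℝ) (c : ℝ) : wN ρ (c • v) = c ^ 2 * wN ρ v := by
  simp only [wN, Pi.smul_apply, smul_eq_mul, Finset.mul_sum]
  exact Finset.sum_congr rfl fun i _ => by ring

omit [Fintype ιf] [DecidableEq ιc] [DecidableEq ιf] in
/-- `wN ρ (a − b − c) ≤ 3(wN ρ a + wN ρ b + wN ρ c)`. [folklore] -/
theorem wN_sub_sub_le (ρ a b c : ιc → ℝ) : wN ρ (a - b - c) ≤ 3 * (wN ρ a + wN ρ b + wN ρ c) := by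
  simp only [wN, Pi.sub_apply, Finset.mul_sum, ← Finset.sum_add_distrib]
  refine Finset.sum_le_sum fun i _ => ?_
  nlinarith [sq_nonneg (Real.exp (ρ i) * (a i + b i)), sq_nonneg (Real.exp (ρ i) * (a i + c i)),
    sq_nonneg (Real.exp (ρ i) * (b i - c i))]

variable (P₀ A₁ : Matrix ιc ιc ℝ) (B : Matrix ιc ιf ℝ) (C : Matrix ιf ιc ℝ) (D : Matrix ιf ιf ℝ)

/-- **THE d∕ds IDENTITY (real twin of `NE7K1LinSchurLine.lineOp_inv_sub_inv`)**: `G(s) − G(t) = (t−s)·G(s)(P₁ − P₀)G(t)`. [folklore] -/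
theorem lineOpR_inv_sub_inv {s t : ℝ} (hs : IsUnit (lineOpR P₀ A₁ B C D s).det) (ht : IsUnit (lineOpR P₀ A₁ B C D t).det) :
    (lineOpR P₀ A₁ B C D s)⁻¹ - (lineOpR P₀ A₁ B C D t)⁻¹ =
      (t - s) • ((lineOpR P₀ A₁ B C D s)⁻¹ * ((A₁ - B * D⁻¹ * C) - P₀) * (lineOpR P₀ A₁ B C D t)⁻¹) := by
  have hsub : lineOpR P₀ A₁ B C D t - lineOpR P₀ A₁ B C D s = (t - s) • ((A₁ - B * D⁻¹ * C) - P₀) := by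
    simp only [lineOpR, smul_sub, sub_smul]; abel
  have key : (lineOpR P₀ A₁ B C D s)⁻¹ * (lineOpR P₀ A₁ B C D t - lineOpR P₀ A₁ B C D s) * (lineOpR P₀ A₁ B C D t)⁻¹ =
      (lineOpR P₀ A₁ B C D s)⁻¹ - (lineOpR P₀ A₁ B C D t)⁻¹ := by
    rw [Matrix.mul_sub, Matrix.sub_mul, Matrix.mul_assoc _ (lineOpR P₀ A₁ B C D t), mul_nonsing_inv _ ht, Matrix.mul_one,
      nonsing_inv_mul _ hs, Matrix.one_mul]
  rw [← key, hsub, Matrix.mul_smul, Matrix.smul_mul]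

omit [DecidableEq ιc] [DecidableEq ιf] in
/-- `D`'s coercivity is `H₁`'s tested on `(0, φ)`. [folklore] -/
theorem coercive_D {σ : ℝ} (hH₁ : ∀ u : ιc ⊕ ιf → ℝ, σ * (u ⬝ᵥ u) ≤ u ⬝ᵥ (fromBlocks A₁ B C D).mulVec u) (φ : ιf → ℝ) :
    σ * (φ ⬝ᵥ φ) ≤ φ ⬝ᵥ D.mulVec φ := by
  have h := hH₁ (Sum.elim 0 φ)
  simpa only [dotProduct, fromBlocks_mulVec, Fintype.sum_sum_type, Sum.elim_inl, Sum.elim_inr, Sum.elim_comp_inl,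
    Sum.elim_comp_inr, Pi.zero_apply, zero_mul, Finset.sum_const_zero, zero_add, mulVec_zero, Pi.add_apply, mul_zero] using h

omit [DecidableEq ιc] [DecidableEq ιf] in
/-- `D`'s conjugation error at `ρ ∘ inr` is `H₁`'s at `ρ` tested on `(0, φ)`. [folklore] -/
theorem conjError_D_ge {σ : ℝ} (ρ : ιc ⊕ ιf → ℝ)
    (h₁ : ∀ u : ιc ⊕ ιf → ℝ, -(σ / 2) * (u ⬝ᵥ u) ≤
      ∑ j, ∑ k, (Real.exp (ρ j - ρ k) - 1) * (fromBlocks A₁ B C D) j k * (u j * u k)) (φ : ιf → ℝ) :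
    -(σ / 2) * (φ ⬝ᵥ φ) ≤ ∑ j, ∑ k, (Real.exp (ρ (Sum.inr j) - ρ (Sum.inr k)) - 1) * D j k * (φ j * φ k) := by
  have h := h₁ (Sum.elim 0 φ)
  simpa only [dotProduct, Fintype.sum_sum_type, Sum.elim_inl, Sum.elim_inr, Pi.zero_apply, zero_mul, mul_zero,
    Finset.sum_const_zero, zero_add, fromBlocks_apply₂₂] using h

omit [DecidableEq ιc] in
/-- **WEIGHTED BOUND FOR THE FINE BLOCK'S INVERSE**: `‖e^{ρ_f}D⁻¹φ‖² ≤ (2∕σ)²‖e^{ρ_f}φ‖²` (`combesThomas_form_op` on `D`). [folklore] -/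
theorem wN_D_inv_le {σ : ℝ} (hσ : 0 < σ) (ρ : ιc ⊕ ιf → ℝ)
    (hH₁ : ∀ u : ιc ⊕ ιf → ℝ, σ * (u ⬝ᵥ u) ≤ u ⬝ᵥ (fromBlocks A₁ B C D).mulVec u)
    (h₁ : ∀ u : ιc ⊕ ιf → ℝ, -(σ / 2) * (u ⬝ᵥ u) ≤
      ∑ j, ∑ k, (Real.exp (ρ j - ρ k) - 1) * (fromBlocks A₁ B C D) j k * (u j * u k)) (φ : ιf → ℝ) :
    wN (ρ ∘ Sum.inr) (D⁻¹.mulVec φ) ≤ (2 / σ) ^ 2 * wN (ρ ∘ Sum.inr) φ := by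
  have hD : IsUnit D.det := isUnit_det_of_coercive D hσ (coercive_D A₁ B C D hH₁)
  have hv : D.mulVec (D⁻¹.mulVec φ) = φ := by rw [mulVec_mulVec, mul_nonsing_inv _ hD, one_mulVec]
  exact combesThomas_form_op D σ (ρ ∘ Sum.inr) hσ (coercive_D A₁ B C D hH₁) (conjError_D_ge A₁ B C D ρ h₁) φ _ hv

/-- **WEIGHTED BOUND FOR THE LINE'S INVERSE, UNIFORM IN `s`**: `‖e^{ρ_c}G(s)v‖² ≤ (2∕σ)²‖e^{ρ_c}v‖²` — `combesThomas_form_op` on the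
√s-extended `𝒫(s)` at the right-hand side `(v, 0)`, whose solution's coarse block is `G(s)v`. [folklore] -/
theorem wN_lineOpR_inv_le {σ : ℝ} (hσ : 0 < σ) (ρ : ιc ⊕ ιf → ℝ)
    (hP₀ : ∀ a : ιc → ℝ, σ * (a ⬝ᵥ a) ≤ a ⬝ᵥ P₀.mulVec a)
    (hH₁ : ∀ u : ιc ⊕ ιf → ℝ, σ * (u ⬝ᵥ u) ≤ u ⬝ᵥ (fromBlocks A₁ B C D).mulVec u)
    (h₀ : ∀ a : ιc → ℝ, -(σ / 2) * (a ⬝ᵥ a) ≤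
      ∑ j, ∑ k, (Real.exp (ρ (Sum.inl j) - ρ (Sum.inl k)) - 1) * P₀ j k * (a j * a k))
    (h₁ : ∀ u : ιc ⊕ ιf → ℝ, -(σ / 2) * (u ⬝ᵥ u) ≤
      ∑ j, ∑ k, (Real.exp (ρ j - ρ k) - 1) * (fromBlocks A₁ B C D) j k * (u j * u k))
    {s : ℝ} (hs0 : 0 ≤ s) (hs1 : s ≤ 1) (v : ιc → ℝ) :
    wN (ρ ∘ Sum.inl) ((lineOpR P₀ A₁ B C D s)⁻¹.mulVec v) ≤ (2 / σ) ^ 2 * wN (ρ ∘ Sum.inl) v := by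
  have hposE := coercive_extOpR P₀ A₁ B C D hP₀ hH₁ hs0 hs1
  have herrE := conjError_extOpR_ge P₀ A₁ B C D ρ h₀ h₁ hs0 hs1
  have hdetE : IsUnit (extOpR P₀ A₁ B C D s).det := isUnit_det_of_coercive _ hσ hposE
  have hD : IsUnit D.det := isUnit_det_fineR A₁ B C D hσ hH₁
  have hL : IsUnit (lineOpR P₀ A₁ B C D s).det := isUnit_det_lineOpR_of_extOpR P₀ A₁ B C D hs0 hD hdetE
  set V : ιc ⊕ ιf → ℝ := (extOpR P₀ A₁ B C D s)⁻¹.mulVec (Sum.elim v 0) with hV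
  have hsolve : (extOpR P₀ A₁ B C D s).mulVec V = Sum.elim v 0 := by
    rw [hV, mulVec_mulVec, mul_nonsing_inv _ hdetE, one_mulVec]
  have hct := combesThomas_form_op (extOpR P₀ A₁ B C D s) σ ρ hσ hposE herrE (Sum.elim v 0) V hsolve
  -- the coarse block of `V` is `G(s)v`
  have hVc : ∀ x, V (Sum.inl x) = ((lineOpR P₀ A₁ B C D s)⁻¹.mulVec v) x := by
    intro x
    simp only [hV, mulVec, dotProduct, Fintype.sum_sum_type, Sum.elim_inl, Sum.elim_inr, Pi.zero_apply, mul_zero,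
      Finset.sum_const_zero, add_zero, inv_extOpR_inl_inl P₀ A₁ B C D hs0 hD hL]
  -- read off
  have hrhs : ∑ i, (Real.exp (ρ i) * Sum.elim v 0 i) ^ 2 = wN (ρ ∘ Sum.inl) v := by
    simp only [wN, Fintype.sum_sum_type, Sum.elim_inl, Sum.elim_inr, Pi.zero_apply, mul_zero, ne_eq,
      OfNat.ofNat_ne_zero, not_false_eq_true, zero_pow, Finset.sum_const_zero, add_zero, Function.comp_apply]
  have hlhs : wN (ρ ∘ Sum.inl) ((lineOpR P₀ A₁ B C D s)⁻¹.mulVec v) ≤ ∑ i, (Real.exp (ρ i) * V i) ^ 2 := by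
    rw [Fintype.sum_sum_type]
    simp only [wN, Function.comp_apply, ← hVc]
    exact le_add_of_nonneg_right (Finset.sum_nonneg fun _ _ => sq_nonneg _)
  rw [hrhs] at hct
  exact hlhs.trans hct

/-- **THE `∂_s` LETTER WITH DECAY (form currency; PRICING-NE7 v16.1 P-v16.1-3 ∕ lens 1 (π1)).**  Under the four hypotheses of
`lineOpR_inv_decay_form` at a weight `ρ` plus weighted `ℓ²` bounds for the four finite-range blocks
(`‖e^{ρ_c}P₀w‖ ≤ K_{P₀}‖e^{ρ_c}w‖`, `‖e^{ρ_c}A₁w‖ ≤ K_{A₁}‖e^{ρ_c}w‖`, `‖e^{ρ_c}Bφ‖ ≤ K_B‖e^{ρ_f}φ‖`, `‖e^{ρ_f}Cw‖ ≤ K_C‖e^{ρ_c}w‖`), for all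
`s, t ∈ [0,1]` and every `g`:
`‖e^{ρ_c}((G(s) − G(t))g)‖² ≤ (t−s)²·(2∕σ)⁴·3·(K_{P₀}² + K_{A₁}² + K_B²(2∕σ)²K_C²)·‖e^{ρ_c}g‖²` — every constant `s`-free. [folklore] -/
theorem wN_lineOpR_inv_sub_inv_le {σ : ℝ} (hσ : 0 < σ) (ρ : ιc ⊕ ιf → ℝ)
    (hP₀ : ∀ a : ιc → ℝ, σ * (a ⬝ᵥ a) ≤ a ⬝ᵥ P₀.mulVec a)
    (hH₁ : ∀ u : ιc ⊕ ιf → ℝ, σ * (u ⬝ᵥ u) ≤ u ⬝ᵥ (fromBlocks A₁ B C D).mulVec u)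
    (h₀ : ∀ a : ιc → ℝ, -(σ / 2) * (a ⬝ᵥ a) ≤
      ∑ j, ∑ k, (Real.exp (ρ (Sum.inl j) - ρ (Sum.inl k)) - 1) * P₀ j k * (a j * a k))
    (h₁ : ∀ u : ιc ⊕ ιf → ℝ, -(σ / 2) * (u ⬝ᵥ u) ≤
      ∑ j, ∑ k, (Real.exp (ρ j - ρ k) - 1) * (fromBlocks A₁ B C D) j k * (u j * u k))
    {KP KA KB KC : ℝ}
    (hKP : ∀ w : ιc → ℝ, wN (ρ ∘ Sum.inl) (P₀.mulVec w) ≤ KP ^ 2 * wN (ρ ∘ Sum.inl) w)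
    (hKA : ∀ w : ιc → ℝ, wN (ρ ∘ Sum.inl) (A₁.mulVec w) ≤ KA ^ 2 * wN (ρ ∘ Sum.inl) w)
    (hKB : ∀ φ : ιf → ℝ, wN (ρ ∘ Sum.inl) (B.mulVec φ) ≤ KB ^ 2 * wN (ρ ∘ Sum.inr) φ)
    (hKC : ∀ w : ιc → ℝ, wN (ρ ∘ Sum.inr) (C.mulVec w) ≤ KC ^ 2 * wN (ρ ∘ Sum.inl) w)
    {s t : ℝ} (hs0 : 0 ≤ s) (hs1 : s ≤ 1) (ht0 : 0 ≤ t) (ht1 : t ≤ 1) (g : ιc → ℝ) :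
    wN (ρ ∘ Sum.inl) (((lineOpR P₀ A₁ B C D s)⁻¹ - (lineOpR P₀ A₁ B C D t)⁻¹).mulVec g) ≤
      (t - s) ^ 2 * (2 / σ) ^ 4 * 3 * (KP ^ 2 + KA ^ 2 + KB ^ 2 * (2 / σ) ^ 2 * KC ^ 2) * wN (ρ ∘ Sum.inl) g := by
  have hs := (lineOpR_inv_decay_form P₀ A₁ B C D hσ ρ hP₀ hH₁ h₀ h₁ hs0 hs1).1
  have ht := (lineOpR_inv_decay_form P₀ A₁ B C D hσ ρ hP₀ hH₁ h₀ h₁ ht0 ht1).1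
  -- abbreviations
  set Gs := (lineOpR P₀ A₁ B C D s)⁻¹ with hGs
  set Gt := (lineOpR P₀ A₁ B C D t)⁻¹ with hGt
  set z : ιc → ℝ := Gt.mulVec g with hz
  set w : ιc → ℝ := A₁.mulVec z - B.mulVec (D⁻¹.mulVec (C.mulVec z)) - P₀.mulVec z with hw
  have hvec : (Gs - Gt).mulVec g = (t - s) • Gs.mulVec w := by
    rw [hGs, hGt, lineOpR_inv_sub_inv P₀ A₁ B C D hs ht, smul_mulVec, ← mulVec_mulVec, ← mulVec_mulVec]
    congr 2
    rw [hw, hz, sub_mulVec, sub_mulVec, ← mulVec_mulVec, ← mulVec_mulVec]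
  -- the chain of weighted bounds
  have h2σ : 0 ≤ (2 / σ) ^ 2 := sq_nonneg _
  have hz_le : wN (ρ ∘ Sum.inl) z ≤ (2 / σ) ^ 2 * wN (ρ ∘ Sum.inl) g :=
    wN_lineOpR_inv_le P₀ A₁ B C D hσ ρ hP₀ hH₁ h₀ h₁ ht0 ht1 g
  have hGw : wN (ρ ∘ Sum.inl) (Gs.mulVec w) ≤ (2 / σ) ^ 2 * wN (ρ ∘ Sum.inl) w :=
    wN_lineOpR_inv_le P₀ A₁ B C D hσ ρ hP₀ hH₁ h₀ h₁ hs0 hs1 w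
  have hA : wN (ρ ∘ Sum.inl) (A₁.mulVec z) ≤ KA ^ 2 * wN (ρ ∘ Sum.inl) z := hKA z
  have hP : wN (ρ ∘ Sum.inl) (P₀.mulVec z) ≤ KP ^ 2 * wN (ρ ∘ Sum.inl) z := hKP z
  have hBDC : wN (ρ ∘ Sum.inl) (B.mulVec (D⁻¹.mulVec (C.mulVec z))) ≤ KB ^ 2 * ((2 / σ) ^ 2 * (KC ^ 2 * wN (ρ ∘ Sum.inl) z)) :=
    (hKB _).trans (mul_le_mul_of_nonneg_left ((wN_D_inv_le A₁ B C D hσ ρ hH₁ h₁ _).trans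
      (mul_le_mul_of_nonneg_left (hKC z) h2σ)) (sq_nonneg _))
  have hw_le : wN (ρ ∘ Sum.inl) w ≤ 3 * ((KA ^ 2 + KB ^ 2 * (2 / σ) ^ 2 * KC ^ 2 + KP ^ 2) * wN (ρ ∘ Sum.inl) z) := by
    have h3 := wN_sub_sub_le (ρ ∘ Sum.inl) (A₁.mulVec z) (B.mulVec (D⁻¹.mulVec (C.mulVec z))) (P₀.mulVec z)
    rw [hw]
    nlinarith [wN_nonneg (ρ ∘ Sum.inl) z]
  rw [hvec, wN_smul]
  have hg0 := wN_nonneg (ρ ∘ Sum.inl) g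
  have hzz := wN_nonneg (ρ ∘ Sum.inl) z
  have hK : 0 ≤ KA ^ 2 + KB ^ 2 * (2 / σ) ^ 2 * KC ^ 2 + KP ^ 2 := by positivity
  have hts : 0 ≤ (t - s) ^ 2 := sq_nonneg _
  calc (t - s) ^ 2 * wN (ρ ∘ Sum.inl) (Gs.mulVec w)
      ≤ (t - s) ^ 2 * ((2 / σ) ^ 2 * (3 * ((KA ^ 2 + KB ^ 2 * (2 / σ) ^ 2 * KC ^ 2 + KP ^ 2) *
          ((2 / σ) ^ 2 * wN (ρ ∘ Sum.inl) g)))) := by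
        refine mul_le_mul_of_nonneg_left (hGw.trans (mul_le_mul_of_nonneg_left (hw_le.trans ?_) h2σ)) hts
        exact mul_le_mul_of_nonneg_left (mul_le_mul_of_nonneg_left hz_le hK) (by norm_num)
    _ = (t - s) ^ 2 * (2 / σ) ^ 4 * 3 * (KP ^ 2 + KA ^ 2 + KB ^ 2 * (2 / σ) ^ 2 * KC ^ 2) * wN (ρ ∘ Sum.inl) g := by ring

end Summit.QuantumFields.BalabanUV.T4Continuum.NE7K1LinSchurLineDeriv
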